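import Summits.RiemannHypothesis.RiemannHypothesis.Theorems.PfPersistenceHalfLineBiasDictionary
import Summits.RiemannHypothesis.RiemannHypothesis.Theorems.PfPersistenceHalfLineBiasScrew
import HarnessLib

/-!
# LANDAU for the half-line Chebyshev bias — VI: Suzuki 2024 Thm 1 discharged; `lim inf B = −∞`; screw readers

Cell `pub-rhpf` (mechanism/rigidity campaign; **no RH claims**), CAND SEAT 7 gen 8, CASE-DAG v6 §6
kernel target LANDAU. Joining the two RH-free halves — MV 15.3 for `B` ((ii) ⇒ (i),
`suzuki2024_thm1_mpr`, file `…HalfLineBiasDictionary`) and the screw identity (RH ⇒ `B(x) ≤ 0` for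
`x ≥ 4`, `suzuki2024_thm1_mp`, file `…HalfLineBiasScrew`):

* `suzuki2024_thm1_holds : Suzuki2024_thm1` — the named fact **M. Suzuki, arXiv:2411.07436, Thm 1**
  (`RH ↔ ∃ x₀ ≥ 2, ∀ x ≥ x₀, B(x) ≤ 0`) is now a theorem of the tree;
* `riemannHypothesis_iff_hlb_eventually_le A` (ANY fixed level `A`: RH ⟺ `B ≤ A` eventually),
  `riemannHypothesis_iff_tendsto_hlb_atBot` (RH ⟺ `B → −∞`);
* **unconditionally** `not_eventually_le_hlb` / `frequently_hlb_lt`: for every `A`, `B(x) < −A` for an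
  unbounded set of `x` — `lim inf B = −∞`, so the LOWER `O(1)` reader of `B` never fires;
* the screw function read one-sidedly (`riemannHypothesis_iff_eventually_zetaScrew_nonneg`,
  `riemannHypothesis_iff_zetaScrew_eventually_ge`, `quasiRiemannHypothesis_of_zetaScrew_lower`,
  `exists_zetaScrew_exp_negative_of_not_riemannHypothesis`): "`Ψ` eventually bounded below ⇒ RH"
  (at the constant scale this is the tree's `IntegerScrewDiscreteLandau.robustLandau` up to
  continuity of `Ψ`; new here are the GRADED readers: `Ψ(t) ≥ −A e^{τt}` or `Ψ(t) ≤ A e^{τt}`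
  eventually ⇒ quasi-RH(1/2 + τ); RH ⟺ `Ψ` eventually bounded ABOVE (`zetaScrew_bddAbove_of_
  riemannHypothesis` from Thm 1.1 (2)); off RH `Ψ = Ω±(e^{δt})`, `zetaScrew_readers`).

For the cell's ledger: in the dilating family the log-Riesz statistic `B` is the one whose `τ = 0`
upper reader is an honest RH-EQUIVALENT (sound under RH, PROVED) — RH-strength by theorem, never
RH-free. Sorry-free.

References: [Suzuki2024] M. Suzuki, *On variants of Chebyshev's conjecture*, arXiv:2411.07436, Thm 1;
[Suzuki2023] M. Suzuki, J. Lond. Math. Soc. 108 (2023), arXiv:2206.03682, Thm 1.7;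
[MontgomeryVaughan2007] §15.1 Thm 15.3.
-/

noncomputable section

-- the sub-problem path RiemannHypothesis/RiemannHypothesis duplicates a namespace (D-0017)
set_option linter.dupNamespace false

open Filter Topology Set

namespace Summit.RiemannHypothesis.RiemannHypothesis.Theorems.PfPersistenceHalfLineBiasSuzuki

open Literature.NumberTheory.LFunctions
open Summit.RiemannHypothesis.RiemannHypothesis.Theorems.PfPersistenceDilatingLandauWeightedMellin
open Summit.RiemannHypothesis.RiemannHypothesis.Theorems.PfPersistenceHalfLineBiasMellin
open Summit.RiemannHypothesis.RiemannHypothesis.Theorems.PfPersistenceHalfLineBiasDictionary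
open Summit.RiemannHypothesis.RiemannHypothesis.Theorems.PfPersistenceHalfLineBiasScrew

/-! ## §1 Suzuki 2024 Theorem 1 -/

/-- **Suzuki 2024 Theorem 1** — discharge of the named fact
`Literature.NumberTheory.LFunctions.Suzuki2024_thm1`: RH holds iff `chebyshevHalfLineBias x ≤ 0`
for all `x ≥ x₀`, for some `x₀ ≥ 2`. (⇒: screw identity + RH ⇒ `Ψ ≥ 0`; ⇐: MV 15.3 for `B`.)
[cite: Suzuki2024, Thm 1] -/
theorem suzuki2024_thm1_holds : Suzuki2024_thm1 :=
  suzuki2024_thm1_of_forward suzuki2024_thm1_mp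

/-- **RH ⟺ `chebyshevHalfLineBias ≤ 0` eventually.** [cite: Suzuki2024, Thm 1] -/
theorem riemannHypothesis_iff_chebyshevHalfLineBias_eventually_nonpos :
    RiemannHypothesis ↔ ∀ᶠ x in atTop, chebyshevHalfLineBias x ≤ 0 := by
  refine ⟨fun hRH ↦ ?_, fun h ↦ ?_⟩
  · filter_upwards [eventually_ge_atTop (4 : ℝ)] with x hx
    exact chebyshevHalfLineBias_nonpos_of_riemannHypothesis hRH hx
  · obtain ⟨x₀, hx₀⟩ := h.exists_forall_of_atTop
    exact riemannHypothesis_of_chebyshevHalfLineBias_nonpos hx₀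

/-- **RH ⟺ `B ≤ A` eventually, for ANY fixed level `A`** (the upper `O(1)` reader of `B` at every
level is an RH-equivalent). [cite: Suzuki2024, Thm 1; MontgomeryVaughan2007, Thm. 15.3] -/
theorem riemannHypothesis_iff_hlb_eventually_le (A : ℝ) :
    RiemannHypothesis ↔ ∀ᶠ x in atTop, hlb x ≤ A := by
  refine ⟨fun hRH ↦ ?_, fun h ↦ riemannHypothesis_of_hlb_le h⟩
  filter_upwards [eventually_hlb_le_of_riemannHypothesis hRH (-A)] with x hx
  rwa [neg_neg] at hx

/-- **RH ⟺ `B` eventually bounded above.** [cite: Suzuki2024, Thm 1; MontgomeryVaughan2007, Thm. 15.3] -/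
theorem riemannHypothesis_iff_hlb_bddAbove :
    RiemannHypothesis ↔ ∃ A : ℝ, ∀ᶠ x in atTop, hlb x ≤ A :=
  ⟨fun hRH ↦ ⟨0, (riemannHypothesis_iff_hlb_eventually_le 0).1 hRH⟩,
    fun ⟨_, h⟩ ↦ riemannHypothesis_of_hlb_le h⟩

/-- **RH ⟺ `B(x) → −∞`** (Suzuki 2024 Thm 1 (i) ⟺ (iii)). [cite: Suzuki2024, Thm 1] -/
theorem riemannHypothesis_iff_tendsto_hlb_atBot :
    RiemannHypothesis ↔ Tendsto hlb atTop atBot :=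
  ⟨tendsto_hlb_atBot_of_riemannHypothesis,
    fun h ↦ riemannHypothesis_of_hlb_le (h.eventually (eventually_le_atBot 0))⟩

/-! ## §2 Unconditionally: `lim inf B = −∞` -/

/-- **Unconditional:** for every `A`, `−A ≤ B(x)` fails for arbitrarily large `x`. (If it held
eventually, MV 15.3 for `B` gives RH, and then `B → −∞` — contradiction.)
[cite: Suzuki2024, Thm 1; MontgomeryVaughan2007, Thm. 15.3] -/
theorem not_eventually_le_hlb (A : ℝ) : ¬ ∀ᶠ x in atTop, -A ≤ hlb x := by
  intro h
  have hRH := riemannHypothesis_of_le_hlb h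
  obtain ⟨x, hx1, hx2⟩ := (h.and (eventually_hlb_le_of_riemannHypothesis hRH (A + 1))).exists
  linarith

/-- **Unconditional:** `B(x) < −A` for an unbounded set of `x`, every `A` (`lim inf B = −∞`).
[cite: Suzuki2024, Thm 1; MontgomeryVaughan2007, Thm. 15.3] -/
theorem frequently_hlb_lt (A : ℝ) : ∃ᶠ x in atTop, hlb x < -A := by
  have h := not_eventually_le_hlb A
  rw [not_eventually] at h
  exact h.mono fun x hx ↦ not_le.1 hx

/-- **Unconditional:** `chebyshevHalfLineBias x < −A` for an unbounded set of `x`, every `A`.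
[cite: Suzuki2024, Thm 1; MontgomeryVaughan2007, Thm. 15.3] -/
theorem frequently_chebyshevHalfLineBias_lt (A : ℝ) : ∃ᶠ x in atTop, chebyshevHalfLineBias x < -A := by
  refine ((frequently_hlb_lt A).and_eventually (eventually_gt_atTop 0)).mono fun x ⟨hx, hx0⟩ ↦ ?_
  rwa [← hlb_eq_chebyshevHalfLineBias hx0]

/-- **The `O(1)` readers of `B`, both sides, settled:** the lower reader never fires (any level), and
the upper reader at any level fires iff RH. [cite: Suzuki2024, Thm 1; MontgomeryVaughan2007, Thm. 15.3] -/
theorem hlb_bdd_readers :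
    (∀ A : ℝ, ¬ ∀ᶠ x in atTop, -A ≤ hlb x) ∧
      ∀ A : ℝ, ((∀ᶠ x in atTop, hlb x ≤ A) ↔ RiemannHypothesis) :=
  ⟨not_eventually_le_hlb, fun A ↦ (riemannHypothesis_iff_hlb_eventually_le A).symm⟩

/-! ## §3 The screw function read one-sidedly -/

/-- **`Ψ` eventually bounded below ⇒ RH.** (By continuity of `Ψ` this hypothesis is the
"`Ψ ≥ −K` on `[0, ∞)`" of `IntegerScrewDiscreteLandau.robustLandau`, proved there by Landau's lemma for
the Laplace transform of `Ψ`; here it drops out of MV 15.3 for `B` through the screw identity, and the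
graded version `quasiRiemannHypothesis_of_zetaScrew_lower` below is what the `B`-route adds.)
[cite: Suzuki2023, Thm 1.7] -/
theorem riemannHypothesis_of_zetaScrew_eventually_ge {M : ℝ} (hΨ : ∀ᶠ t in atTop, -M ≤ zetaScrew t) :
    RiemannHypothesis := by
  refine riemannHypothesis_of_hlb_le (A := 3 + M) ?_
  filter_upwards [eventually_hlb_le_of_zetaScrew_ge hΨ, eventually_ge_atTop (1 : ℝ)] with x hx hx1
  have hlog : 0 ≤ Real.log x := Real.log_nonneg hx1
  linarith

/-- **`Ψ ≥ 0` eventually ⇒ RH.** [cite: Suzuki2023, Thm 1.7] -/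
theorem riemannHypothesis_of_eventually_zetaScrew_nonneg (hΨ : ∀ᶠ t in atTop, 0 ≤ zetaScrew t) :
    RiemannHypothesis :=
  riemannHypothesis_of_zetaScrew_eventually_ge (M := 0) (by simpa using hΨ)

/-- **RH ⟺ `Ψ ≥ 0` eventually** (cf. Suzuki 2023 Thm 1.7: RH ⟺ `Ψ ≥ 0` everywhere).
[cite: Suzuki2023, Thm 1.7] -/
theorem riemannHypothesis_iff_eventually_zetaScrew_nonneg :
    RiemannHypothesis ↔ ∀ᶠ t in atTop, 0 ≤ zetaScrew t :=
  ⟨fun hRH ↦ Eventually.of_forall (ZetaScrewThm17.zetaScrew_nonneg_of_RH hRH),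
    riemannHypothesis_of_eventually_zetaScrew_nonneg⟩

/-- **RH ⟺ `Ψ` eventually bounded below.** [cite: Suzuki2023, Thm 1.7] -/
theorem riemannHypothesis_iff_zetaScrew_eventually_ge :
    RiemannHypothesis ↔ ∃ M : ℝ, ∀ᶠ t in atTop, -M ≤ zetaScrew t :=
  ⟨fun hRH ↦ ⟨0, Eventually.of_forall fun t ↦ by
      simpa using ZetaScrewThm17.zetaScrew_nonneg_of_RH hRH t⟩,
    fun ⟨_, h⟩ ↦ riemannHypothesis_of_zetaScrew_eventually_ge h⟩

/-- **`Ψ(t) ≥ −A e^{τ t}` eventually (`τ ≥ 0`) ⇒ quasi-RH(1/2 + τ)**: the exponential-scale lower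
readers of the screw function are graded exactly like the power-scale upper readers of `B`.
[cite: Suzuki2023, Thm 1.7; MontgomeryVaughan2007, Thm. 15.3] -/
theorem quasiRiemannHypothesis_of_zetaScrew_lower {A τ : ℝ} (hτ : 0 ≤ τ)
    (hΨ : ∀ᶠ t in atTop, -(A * Real.exp (τ * t)) ≤ zetaScrew t) :
    QuasiRiemannHypothesis (1 / 2 + τ) := by
  refine quasiRiemannHypothesis_of_hlb_oneSided (η := 1) (A := A + 3) (Or.inl rfl) hτ ?_
  filter_upwards [eventually_hlb_le_rpow_of_zetaScrew_ge hτ hΨ] with x hx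
  rwa [one_mul]

/-- **Off RH the screw function is exponentially negative infinitely often:** if RH fails there are
`δ > 0`, `c > 0` with `Ψ(t) ≤ −c e^{δ t}` for an unbounded set of `t`.
[cite: Suzuki2023, Thm 1.7; MontgomeryVaughan2007, Thm. 15.3] -/
theorem exists_zetaScrew_exp_negative_of_not_riemannHypothesis (hRH : ¬ RiemannHypothesis) :
    ∃ δ c : ℝ, 0 < δ ∧ 0 < c ∧ ∃ᶠ t in atTop, zetaScrew t ≤ -(c * Real.exp (δ * t)) := by
  by_contra hno
  obtain ⟨δ, c, hδ, hc, hup, -⟩ := exists_hlb_oscillation_of_not_riemannHypothesis hRH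
  have hev : ∀ᶠ t in atTop, -(c / 2 * Real.exp (δ * t)) ≤ zetaScrew t := by
    have h : ¬ ∃ᶠ t in atTop, zetaScrew t ≤ -(c / 2 * Real.exp (δ * t)) :=
      fun hf ↦ hno ⟨δ, c / 2, hδ, by positivity, hf⟩
    rw [not_frequently] at h
    exact h.mono fun t ht ↦ (not_le.1 ht).le
  have hB : ∀ᶠ x in atTop, hlb x < c * x ^ δ := by
    filter_upwards [Real.tendsto_log_atTop.eventually hev, eventually_ge_atTop (1 : ℝ),
      (tendsto_rpow_atTop hδ).eventually_gt_atTop (6 / c)] with x h hx1 hbig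
    have hx0 : 0 < x := by linarith
    have hexp : Real.exp (δ * Real.log x) = x ^ δ := by rw [Real.rpow_def_of_pos hx0, mul_comm]
    rw [hexp] at h
    have h1 := hlb_add_zetaScrew_le hx1
    have hlog : 0 ≤ Real.log x := Real.log_nonneg hx1
    have h6 : 6 < c * x ^ δ := by
      have := (div_lt_iff₀ hc).1 hbig
      linarith [mul_comm (x ^ δ) c]
    linarith
  obtain ⟨x, hx1, hx2⟩ := (hup.and_eventually hB).exists
  linarith

/-! ## §4 Upper readers of the screw function -/

/-- `L = γ₀ + π/2 + 3 log 2 + log π ≤ 6` (`γ₀ < 2/3`, `π < 3.15`, `log 2 < 0.6932`, `log π < log 4`).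
[folklore] -/
theorem screwSlope_le_six :
    Real.eulerMascheroniConstant + Real.pi / 2 + 3 * Real.log 2 + Real.log Real.pi ≤ 6 := by
  have hγ := Real.eulerMascheroniConstant_lt_two_thirds
  have hπ := Real.pi_lt_d2
  have h2 := Real.log_two_lt_d9
  have hlogπ : Real.log Real.pi ≤ 2 * Real.log 2 := by
    rw [← Real.log_rpow two_pos, Real.log_le_log_iff Real.pi_pos (by positivity)]
    have : (2 : ℝ) ^ (2 : ℝ) = 4 := by norm_num
    linarith [Real.pi_lt_four]
  linarith

/-- **An upper bound on `Ψ` at `t = log x` is a lower bound on `B(x)`:**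
`Ψ(log x) ≤ A ⇒ −B(x) ≤ 8 + A + 3 log x` (`x ≥ 1`; uses `Φ(e^{-2t},2,1/4) ≤ C`).
[cite: Suzuki2023, (1.1)] -/
theorem neg_hlb_le_of_zetaScrew_le {x A : ℝ} (hx : 1 ≤ x) (hΨ : zetaScrew (Real.log x) ≤ A) :
    -hlb x ≤ 8 + A + 3 * Real.log x := by
  have hx0 : 0 < x := by linarith
  have hid := hlb_add_zetaScrew hx
  have hL := screwSlope_le_six
  have hxr : x ^ (-(1 / 2 : ℝ)) ≤ 1 := Real.rpow_le_one_of_one_le_of_nonpos hx (by norm_num)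
  have hxr0 : 0 ≤ x ^ (-(1 / 2 : ℝ)) := Real.rpow_nonneg hx0.le _
  have hH0 := hurwitzLerchQuarter_nonneg (Real.log x)
  have hHC : x ^ (-(1 / 2 : ℝ)) * hurwitzLerchQuarter (Real.log x) ≤
      ∑' k : ℕ, 1 / ((k : ℝ) + 1 / 4) ^ 2 :=
    (mul_le_of_le_one_left hH0 hxr).trans (hurwitzLerchQuarter_le _)
  have hlog : 0 ≤ Real.log x := Real.log_nonneg hx
  nlinarith

/-- **`Ψ` eventually bounded above ⇒ RH** (through the LOWER `x^ε` readers of `B`: `−B(x) ≤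
8 + A + 3 log x ≤ x^ε` eventually, and MV 15.3 for `B` at every `ε > 0`).
[cite: Suzuki2023, Thm 1.7; MontgomeryVaughan2007, Thm. 15.3] -/
theorem riemannHypothesis_of_zetaScrew_eventually_le {A : ℝ} (hΨ : ∀ᶠ t in atTop, zetaScrew t ≤ A) :
    RiemannHypothesis := by
  refine quasiRiemannHypothesis_one_half_iff_holds.1 fun s hs hσs h1 ↦ ?_
  set τ : ℝ := (s.re - 1 / 2) / 2 with hτdef
  have hτ : 0 < τ := by rw [hτdef]; linarith
  have hq : QuasiRiemannHypothesis (1 / 2 + τ) := by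
    refine quasiRiemannHypothesis_of_hlb_oneSided (η := -1) (A := |A| + 8 + 3 / τ) (Or.inr rfl)
      hτ.le ?_
    filter_upwards [Real.tendsto_log_atTop.eventually hΨ, eventually_ge_atTop (1 : ℝ)] with x h hx1
    have hx0 : 0 < x := by linarith
    have hb := neg_hlb_le_of_zetaScrew_le hx1 h
    have hxτ : 1 ≤ x ^ τ := Real.one_le_rpow hx1 hτ.le
    have hlogle : Real.log x ≤ x ^ τ / τ := Real.log_le_rpow_div hx0.le hτ
    have hA : A ≤ |A| * x ^ τ := (le_abs_self A).trans (le_mul_of_one_le_right (abs_nonneg A) hxτ)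
    have hl := (le_div_iff₀ hτ).1 hlogle
    have h3 : 3 * Real.log x ≤ 3 / τ * x ^ τ := by
      rw [div_mul_eq_mul_div, le_div_iff₀ hτ]
      linarith
    nlinarith
  exact hq s hs (by linarith) h1

/-- **`Ψ(t) ≤ A e^{τt}` eventually (`τ > 0`) ⇒ quasi-RH(1/2 + τ).**
[cite: Suzuki2023, Thm 1.7; MontgomeryVaughan2007, Thm. 15.3] -/
theorem quasiRiemannHypothesis_of_zetaScrew_upper {A τ : ℝ} (hτ : 0 < τ)
    (hΨ : ∀ᶠ t in atTop, zetaScrew t ≤ A * Real.exp (τ * t)) :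
    QuasiRiemannHypothesis (1 / 2 + τ) := by
  refine quasiRiemannHypothesis_of_hlb_oneSided (η := -1) (A := |A| + 8 + 3 / τ) (Or.inr rfl)
    hτ.le ?_
  filter_upwards [Real.tendsto_log_atTop.eventually hΨ, eventually_ge_atTop (1 : ℝ)] with x h hx1
  have hx0 : 0 < x := by linarith
  have hexp : Real.exp (τ * Real.log x) = x ^ τ := by rw [Real.rpow_def_of_pos hx0, mul_comm]
  rw [hexp] at h
  have hb := neg_hlb_le_of_zetaScrew_le hx1 h
  have hxτ : 1 ≤ x ^ τ := Real.one_le_rpow hx1 hτ.le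
  have hlogle : Real.log x ≤ x ^ τ / τ := Real.log_le_rpow_div hx0.le hτ
  have hA : A * x ^ τ ≤ |A| * x ^ τ := mul_le_mul_of_nonneg_right (le_abs_self A) (by linarith)
  have hl := (le_div_iff₀ hτ).1 hlogle
  have h3 : 3 * Real.log x ≤ 3 / τ * x ^ τ := by
    rw [div_mul_eq_mul_div, le_div_iff₀ hτ]
    linarith
  nlinarith

/-- **RH ⇒ `Ψ` is bounded** (`Ψ(t) = Σ_ρ m(ρ)(1 − cos γt)/γ² ≤ 2 Σ_ρ m(ρ)/γ²`, Suzuki 2023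
Thm 1.1 (2) on the critical line, `ZetaScrewThm17.hasSum_real`; `Σ m(ρ)/(1+γ²) < ∞` and `|γ| ≥ 2δ`).
[cite: Suzuki2023, Thm 1.1 (2), Thm 1.7] -/
theorem zetaScrew_bddAbove_of_riemannHypothesis (hRH : RiemannHypothesis) :
    ∃ M : ℝ, ∀ t : ℝ, zetaScrew t ≤ M := by
  obtain ⟨δ, hδ, -, hgap⟩ := ZetaZeroSum.exists_gap_im
  set K : ℝ := 1 + 1 / (4 * δ ^ 2) with hK
  have hS : Summable fun ρ : ZetaZeros.riemannZetaNontrivialZeros ↦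
      (riemannZetaZeroOrder (ρ : ℂ) : ℝ) / (1 + (ρ : ℂ).im ^ 2) :=
    ZetaZeroSum.summable_zeroOrder_div_one_add_sq
  refine ⟨∑' ρ : ZetaZeros.riemannZetaNontrivialZeros,
    2 * K * ((riemannZetaZeroOrder (ρ : ℂ) : ℝ) / (1 + (ρ : ℂ).im ^ 2)), fun t ↦ ?_⟩
  refine hasSum_le (fun ρ ↦ ?_) (ZetaScrewThm17.hasSum_real hRH t) (hS.mul_left (2 * K)).hasSum
  have hm0 : (0 : ℝ) ≤ riemannZetaZeroOrder (ρ : ℂ) := by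
    have := ZetaZeros.riemannZetaNontrivialZeros.one_le_order ρ.2
    exact_mod_cast (show (0 : ℤ) ≤ riemannZetaZeroOrder (ρ : ℂ) by omega)
  have hγ : 2 * δ ≤ |(ρ : ℂ).im| := hgap _ ρ.2
  have hγ2 : 4 * δ ^ 2 ≤ (ρ : ℂ).im ^ 2 := by
    nlinarith [sq_abs ((ρ : ℂ).im), abs_nonneg ((ρ : ℂ).im)]
  have hγpos : 0 < (ρ : ℂ).im ^ 2 := by nlinarith
  have hcos : 1 - Real.cos ((ρ : ℂ).im * t) ≤ 2 := by linarith [Real.neg_one_le_cos ((ρ : ℂ).im * t)]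
  have h1 : (1 - Real.cos ((ρ : ℂ).im * t)) / (ρ : ℂ).im ^ 2 ≤ 2 * K / (1 + (ρ : ℂ).im ^ 2) := by
    rw [div_le_div_iff₀ hγpos (by positivity)]
    have hKγ : 1 + (ρ : ℂ).im ^ 2 ≤ K * (ρ : ℂ).im ^ 2 := by
      rw [hK, add_mul, one_mul, add_comm]
      gcongr
      rw [div_mul_eq_mul_div, one_mul, le_div_iff₀ (by positivity)]
      linarith
    nlinarith
  calc (riemannZetaZeroOrder (ρ : ℂ) : ℝ) * ((1 - Real.cos ((ρ : ℂ).im * t)) / (ρ : ℂ).im ^ 2)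
      ≤ (riemannZetaZeroOrder (ρ : ℂ) : ℝ) * (2 * K / (1 + (ρ : ℂ).im ^ 2)) :=
        mul_le_mul_of_nonneg_left h1 hm0
    _ = 2 * K * ((riemannZetaZeroOrder (ρ : ℂ) : ℝ) / (1 + (ρ : ℂ).im ^ 2)) := by ring

/-- **RH ⟺ `Ψ` eventually bounded above.** [cite: Suzuki2023, Thm 1.1 (2), Thm 1.7; MontgomeryVaughan2007, Thm. 15.3] -/
theorem riemannHypothesis_iff_zetaScrew_eventually_le :
    RiemannHypothesis ↔ ∃ A : ℝ, ∀ᶠ t in atTop, zetaScrew t ≤ A :=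
  ⟨fun hRH ↦ (zetaScrew_bddAbove_of_riemannHypothesis hRH).imp fun _ h ↦ Eventually.of_forall h,
    fun ⟨_, h⟩ ↦ riemannHypothesis_of_zetaScrew_eventually_le h⟩

/-- **Off RH the screw function is exponentially POSITIVE infinitely often, too:** if RH fails there
are `δ > 0`, `c > 0` with `Ψ(t) ≥ c e^{δt}` for an unbounded set of `t`.
[cite: Suzuki2023, Thm 1.7; MontgomeryVaughan2007, Thm. 15.3] -/
theorem exists_zetaScrew_exp_positive_of_not_riemannHypothesis (hRH : ¬ RiemannHypothesis) :
    ∃ δ c : ℝ, 0 < δ ∧ 0 < c ∧ ∃ᶠ t in atTop, c * Real.exp (δ * t) ≤ zetaScrew t := by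
  by_contra hno
  obtain ⟨δ, c, hδ, hc, -, hdown⟩ := exists_hlb_oscillation_of_not_riemannHypothesis hRH
  have hev : ∀ᶠ t in atTop, zetaScrew t ≤ c / 4 * Real.exp (δ * t) := by
    have h : ¬ ∃ᶠ t in atTop, c / 4 * Real.exp (δ * t) ≤ zetaScrew t :=
      fun hf ↦ hno ⟨δ, c / 4, hδ, by positivity, hf⟩
    rw [not_frequently] at h
    exact h.mono fun t ht ↦ (not_le.1 ht).le
  have hB : ∀ᶠ x in atTop, -(c * x ^ δ) < hlb x := by
    filter_upwards [Real.tendsto_log_atTop.eventually hev, eventually_ge_atTop (1 : ℝ),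
      (tendsto_rpow_atTop hδ).eventually_gt_atTop (32 / c),
      (isLittleO_log_rpow_atTop hδ).bound (show (0 : ℝ) < c / 8 by positivity)] with x h hx1 hbig hlg
    have hx0 : 0 < x := by linarith
    have hexp : Real.exp (δ * Real.log x) = x ^ δ := by rw [Real.rpow_def_of_pos hx0, mul_comm]
    rw [hexp] at h
    have hb := neg_hlb_le_of_zetaScrew_le hx1 h
    have hxδ0 : 0 < x ^ δ := Real.rpow_pos_of_pos hx0 δ
    have hlg' : Real.log x ≤ c / 8 * x ^ δ := by
      have := hlg
      rw [Real.norm_of_nonneg (Real.log_nonneg hx1), Real.norm_of_nonneg hxδ0.le] at this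
      exact this
    have h32 : 32 < c * x ^ δ := by
      have := (div_lt_iff₀ hc).1 hbig
      linarith [mul_comm (x ^ δ) c]
    nlinarith
  obtain ⟨x, hx1, hx2⟩ := (hdown.and_eventually hB).exists
  linarith

/-- **The screw function, summarised:** RH ⟺ `Ψ` eventually bounded below ⟺ `Ψ` eventually
bounded above (under RH `0 ≤ Ψ ≤ M`); and off RH `Ψ` takes both signs at exponential scale
infinitely often. [cite: Suzuki2023, Thm 1.7; MontgomeryVaughan2007, Thm. 15.3] -/
theorem zetaScrew_readers :
    (RiemannHypothesis ↔ ∃ M : ℝ, ∀ᶠ t in atTop, -M ≤ zetaScrew t) ∧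
      (RiemannHypothesis ↔ ∃ A : ℝ, ∀ᶠ t in atTop, zetaScrew t ≤ A) ∧
      (¬ RiemannHypothesis → ∃ δ c : ℝ, 0 < δ ∧ 0 < c ∧
        (∃ᶠ t in atTop, c * Real.exp (δ * t) ≤ zetaScrew t) ∧
          ∃ᶠ t in atTop, zetaScrew t ≤ -(c * Real.exp (δ * t))) := by
  refine ⟨riemannHypothesis_iff_zetaScrew_eventually_ge,
    riemannHypothesis_iff_zetaScrew_eventually_le, fun hRH ↦ ?_⟩
  obtain ⟨δ₁, c₁, hδ₁, hc₁, h₁⟩ := exists_zetaScrew_exp_positive_of_not_riemannHypothesis hRH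
  obtain ⟨δ₂, c₂, hδ₂, hc₂, h₂⟩ := exists_zetaScrew_exp_negative_of_not_riemannHypothesis hRH
  refine ⟨min δ₁ δ₂, min c₁ c₂, lt_min hδ₁ hδ₂, lt_min hc₁ hc₂, ?_, ?_⟩
  · refine (h₁.and_eventually (eventually_ge_atTop 0)).mono fun t ⟨ht, ht0⟩ ↦ le_trans ?_ ht
    exact mul_le_mul (min_le_left _ _) (Real.exp_le_exp.2 (by nlinarith [min_le_left δ₁ δ₂]))
      (Real.exp_pos _).le hc₁.le
  · refine (h₂.and_eventually (eventually_ge_atTop 0)).mono fun t ⟨ht, ht0⟩ ↦ ht.trans ?_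
    exact neg_le_neg (mul_le_mul (min_le_right _ _)
      (Real.exp_le_exp.2 (by nlinarith [min_le_right δ₁ δ₂])) (Real.exp_pos _).le hc₂.le)

end Summit.RiemannHypothesis.RiemannHypothesis.Theorems.PfPersistenceHalfLineBiasSuzuki

end
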